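import Summits.QuantumAdvantage.QuantumAdvantage.Theorems.CubicForrelationNearExactIsExactTwelveTypeO992Below929

/-!
# Crux `CubicForrelation.NearExactIsExact` (stmt-QuantumAdvantage-14043) — n = 12, type O with base set `992` AT the boundary `Φ = 29/32`
  (excess `256`, `Σ v² ≤ 16`): the partner is NOT type O, and the wild function is `16` aligned points (`Σ v² = 16`, `v̂ ∈ {0, ±16}`,
  `v̂ ≠ 0` on exactly `256` characters)

Certificate seat `b2b-cforr-cert` (gen 22).  HONEST FRAMING: a kernel-checked DICHOTOMY (standard axioms, no `decide`) about cubic Boolean pairs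
on 12 bits — the base-`992` configuration of the boundary rung `29/32 = 928/1024` (HOME/b2b-cforr-cert-g20/PLAN-N12-928.md): it is reduced to
ONE rigid wild-function shape with a partner at level `≥ 5`; the level-5 / level-`≥ 6` partners (which need the parity structure of the
character sums `Ê(z)/32` of the weight-`992` cubic support) are NOT killed here.  NO new value of `θ₁₂`.  NOT summit progress.

* `to22_wild_engine16_dichotomy`: `f` cubic, `W_f = 16u_f`, `Σ v² ≤ 16`, `v̂ = 8k`, `k ≡ u_f (mod 2)`: either `v ≡ 0`, or `u_f` is even
  everywhere, `Σ v² = 16`, `k ∈ {0, ±2}` and `#{k ≠ 0} = 256` (`|v̂| ≤ Σ|v| ≤ Σ v² ≤ 16` gives `|k| ≤ 2`; `u_f` odd ⇒ `k` odd everywhere ⇒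
  `Σ k² ≥ 4096 > 64·16`; `k` even and `≢ 0` ⇒ some `|v̂| = 16` ⇒ `Σ v² = 16` ⇒ `Σ k² = 1024 = 4·#{k ≠ 0}`).
* `to22_typeO_E992_ge2932_dichotomy`: type O (`W_g = 16u`, some `u` odd), `#E = 992`, `Φ ≥ 29/32` ⇒ `Φ = 29/32` and the second alternative
  holds for the partner `f` and the wild function `v` of `u − 4(−1)^f = τ₀ + 8v` (at `Φ ≥ 930/1024` by `to20_typeO_ge930_false`; below, the budget
  `Σ τ² ≤ 12288` gives `Σ v² ≤ 16`, the partner identity and `to20_char_sum_E992` give `v̂ = 8k`, `k ≡ u_f (mod 2)`, and `v ≡ 0` would mean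
  `Φ = 930/1024`).
* `to22_typeO_E992_typeO_partner_false`: in particular NO type-O × type-O pair with a base set of `992` points at `Φ ≥ 29/32`.

References: Kasami–Tokura (1970); MacWilliams–Sloane (1977) Ch. 14–15; Carlet (2021) §5.2; O'Donnell (2014) §1.4, §3.3.  Axioms: the standard three.
-/

set_option linter.dupNamespace false -- D-0017: single-problem summit ⇒ `QuantumAdvantage.QuantumAdvantage` by design

noncomputable section

namespace Summit.QuantumAdvantage.QuantumAdvantage.Theorems.CubicForrelation.NearExactIsExact

open Finset
open Literature.Computability.QuantumComplexity
open Literature.Computability.QuantumComplexity.BuzetChailloux (bxor zeroVec bxor_bxor_cancel_left bxor_zeroVec zeroVec_bxor bxor_comm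
  bxor_self twist_zeroVec_right twist_bxor_right)
open Literature.Computability.QuantumComplexity.DerivativeWalsh (W sum_W_sq)
open Literature.Computability.QuantumComplexity.Simon (twist_eq_one_or)
open Summit.QuantumAdvantage.QuantumAdvantage.Theorems.NearExactIsExact.Negative (TypeOTwelve.typeO_of_exists_odd)

/-! ### The small wild-function engine at `Σ v² ≤ 16`: a dichotomy -/

/-- **Wild-function engine at `Σ v² ≤ 16`, dichotomy form.**  `f` cubic on 12 bits with `W_f = 16·u_f`, an integer function `v` with
`Σ v² ≤ 16` and `v̂(y) = 8k(y)`, `k(y) ≡ u_f(y) (mod 2)`: either `v ≡ 0`, or `u_f` is even everywhere, `Σ v² = 16`, every `k(y) ∈ {0, ±2}`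
and exactly `256` of them are non-zero.  See the module docstring. [this work] -/
theorem to22_wild_engine16_dichotomy (f : (Fin (6 + 6) → Bool) → Bool) (hf : IsDegLeFun 3 f)
    (uf : (Fin (6 + 6) → Bool) → ℤ) (huf : ∀ y, W (fun x => signOf (f x)) y = (2 : ℝ) ^ 4 * (uf y : ℝ))
    (v : (Fin (6 + 6) → Bool) → ℤ) (hV : ∑ x, v x ^ 2 ≤ 16)
    (k : (Fin (6 + 6) → Bool) → ℤ) (hk : ∀ y, ∑ x, (v x : ℝ) * twist x y = 8 * (k y : ℝ)) (hk2 : ∀ y, (2 : ℤ) ∣ k y + uf y) :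
    (∀ x, v x = 0) ∨
    ((∀ y, ¬ Odd (uf y)) ∧ ∑ x, v x ^ 2 = 16 ∧ (∀ y, k y = 0 ∨ k y = 2 ∨ k y = -2) ∧
      #(univ.filter fun y : Fin (6 + 6) → Bool => k y ≠ 0) = 256) := by
  classical
  have hpars : ∑ y, (∑ x, (v x : ℝ) * twist x y) ^ 2 = 4096 * ∑ x, ((v x : ℝ)) ^ 2 := by
    have h := sum_W_sq (n := 6 + 6) (fun x => (v x : ℝ))
    unfold W at h
    rw [h]; norm_num
  have hV' : ∑ x, ((v x : ℝ)) ^ 2 ≤ 16 := by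
    have : ((∑ x, v x ^ 2 : ℤ) : ℝ) ≤ 16 := by exact_mod_cast hV
    push_cast at this; exact this
  have hk2eq : ∑ y, ((k y : ℝ)) ^ 2 = 64 * ∑ x, ((v x : ℝ)) ^ 2 := by
    have e : ∑ y, (∑ x, (v x : ℝ) * twist x y) ^ 2 = 64 * ∑ y, ((k y : ℝ)) ^ 2 := by
      rw [mul_sum]; exact sum_congr rfl fun y _ => by rw [hk y]; ring
    rw [e] at hpars
    linarith
  have hk2sum : ∑ y, ((k y : ℝ)) ^ 2 ≤ 1024 := by rw [hk2eq]; linarith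
  -- `|v̂(y)| ≤ Σ|v| ≤ Σ v²`
  have hvhat_le : ∀ y, |∑ x, (v x : ℝ) * twist x y| ≤ ∑ x, ((v x : ℝ)) ^ 2 := by
    intro y
    calc |∑ x, (v x : ℝ) * twist x y| ≤ ∑ x, |(v x : ℝ) * twist x y| := abs_sum_le_sum_abs _ _
      _ = ∑ x, |(v x : ℝ)| := sum_congr rfl fun x _ => by
          rw [abs_mul]; rcases twist_eq_one_or x y with h | h <;> rw [h] <;> simp
      _ ≤ ∑ x, ((v x : ℝ)) ^ 2 := sum_le_sum fun x _ => by
          rw [← Int.cast_abs]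
          have habs : |v x| ≤ v x ^ 2 := by
            rcases le_or_gt 0 (v x) with h | h
            · rw [abs_of_nonneg h]; nlinarith
            · rw [abs_of_neg h]; nlinarith
          exact_mod_cast habs
  have hkabs : ∀ y, |k y| ≤ 2 := by
    intro y
    have h1 : |∑ x, (v x : ℝ) * twist x y| ≤ 16 := (hvhat_le y).trans hV'
    rw [hk y, abs_mul, abs_of_nonneg (by norm_num : (0:ℝ) ≤ 8)] at h1
    have h2 : ((8 * |k y| : ℤ) : ℝ) ≤ 16 := by push_cast; exact h1
    have h3 : (8 * |k y| : ℤ) ≤ 16 := by exact_mod_cast h2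
    omega
  by_cases hO : ∃ y, Odd (uf y)
  · -- all `u_f` odd: every `k` odd, `Σ k² ≥ 4096 > 1024`
    exfalso
    obtain ⟨y₁, hy₁⟩ := hO
    have hdeg := stub_walshTower stub_axParity (6 + 6) 4 0 f uf hf huf (by intro j hj hjn; omega)
    have hallodd : ∀ y, Odd (uf y) := by
      intro y
      have h := tc_const_of_deg_zero hdeg y y₁
      have h1 : decide (Odd (uf y₁)) = true := by simpa using hy₁
      rw [h1] at h
      simpa using h
    have hk1 : ∀ y, (1 : ℝ) ≤ ((k y : ℝ)) ^ 2 := by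
      intro y
      obtain ⟨j, hj⟩ := hk2 y
      have h0 := Int.odd_iff.1 (hallodd y)
      have : k y ≤ -1 ∨ 1 ≤ k y := by omega
      have hsq := tp_sq_ge (k := 1) (by norm_num) this
      exact_mod_cast hsq
    have h1 : ∑ y, (1 : ℝ) ≤ ∑ y, ((k y : ℝ)) ^ 2 := sum_le_sum fun y _ => hk1 y
    rw [sum_const, card_univ, Fintype.card_fun, Fintype.card_bool, Fintype.card_fin] at h1
    norm_num at h1
    linarith
  push Not at hO
  -- `k` is even, `|k| ≤ 2`
  have hkval : ∀ y, k y = 0 ∨ k y = 2 ∨ k y = -2 := by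
    intro y
    obtain ⟨j, hj⟩ := hk2 y
    obtain ⟨i, hi⟩ := Int.not_odd_iff_even.1 (hO y)
    have h3 := hkabs y
    rw [abs_le] at h3
    omega
  by_cases hk0 : ∀ y, k y = 0
  · left
    have hvhat0 : ∑ y, (∑ x, (v x : ℝ) * twist x y) ^ 2 = 0 :=
      sum_eq_zero fun y _ => by rw [hk y, hk0 y]; norm_num
    rw [hpars] at hvhat0
    have hsum0 : ∑ x, ((v x : ℝ)) ^ 2 = 0 := by linarith
    intro x
    have := (sum_eq_zero_iff_of_nonneg fun z _ => sq_nonneg ((v z : ℝ))).1 hsum0 x (mem_univ x)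
    exact_mod_cast pow_eq_zero_iff two_ne_zero |>.1 this
  · right
    push Not at hk0
    obtain ⟨y₀, hy₀⟩ := hk0
    -- `|v̂(y₀)| = 16` forces `Σ v² = 16`
    have h16 : (16 : ℝ) ≤ ∑ x, ((v x : ℝ)) ^ 2 := by
      have h1 := hvhat_le y₀
      rw [hk y₀, abs_mul, abs_of_nonneg (by norm_num : (0:ℝ) ≤ 8)] at h1
      have hk2' : (2 : ℝ) ≤ |(k y₀ : ℝ)| := by
        rw [← Int.cast_abs]
        have : (2 : ℤ) ≤ |k y₀| := by
          rcases hkval y₀ with h | h | h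
          · exact absurd h hy₀
          · rw [h]; norm_num
          · rw [h]; norm_num
        exact_mod_cast this
      linarith
    have hVeq : ∑ x, v x ^ 2 = 16 := by
      have : (16 : ℝ) ≤ ((∑ x, v x ^ 2 : ℤ) : ℝ) := by push_cast; exact h16
      have : (16 : ℤ) ≤ ∑ x, v x ^ 2 := by exact_mod_cast this
      exact le_antisymm hV this
    refine ⟨hO, hVeq, hkval, ?_⟩
    -- `Σ k² = 1024` with `k² ∈ {0, 4}`
    have hk2val : ∑ y, ((k y : ℝ)) ^ 2 = 1024 := by
      rw [hk2eq]
      have : ((∑ x, v x ^ 2 : ℤ) : ℝ) = 16 := by exact_mod_cast hVeq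
      push_cast at this
      rw [this]; norm_num
    have hsq : ∀ y, ((k y : ℝ)) ^ 2 = 4 * (if k y ≠ 0 then (1 : ℝ) else 0) := by
      intro y
      rcases hkval y with h | h | h <;> simp [h] <;> norm_num
    rw [sum_congr rfl fun y _ => hsq y, ← mul_sum, sum_boole] at hk2val
    have h : ((#(univ.filter fun y : Fin (6 + 6) → Bool => k y ≠ 0) : ℕ) : ℝ) = 256 := by
      linarith
    exact_mod_cast h

/-! ### Base set `992` at `Φ ≥ 29/32`: the dichotomy collapses to `Φ = 29/32` with sixteen aligned wild points -/

/-- **Type O, `#E = 992`, `Φ ≥ 29/32` on 12 bits: `Φ = 29/32`, the partner `f` is at level `≥ 5` (`u_f = W_f/16` even everywhere), and the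
wild function `v` of `u − 4(−1)^f = τ₀ + 8v` has `Σ v² = 16` with `v̂ = 8k`, `k ∈ {0, ±2}` non-zero on exactly `256` characters and
`k ≡ u_f (mod 2)`.**  See the module docstring.  Finite-slice statement; NOT summit progress. [this work] -/
theorem to22_typeO_E992_ge2932_dichotomy (f g : (Fin (6 + 6) → Bool) → Bool) (hf : IsDegLeFun 3 f) (hg : IsDegLeFun 3 g)
    (u : (Fin (6 + 6) → Bool) → ℤ) (hu : ∀ x, W (fun y => signOf (g y)) x = (2 : ℝ) ^ 4 * (u x : ℝ))
    (hodd : ∃ x, Odd (u x)) (hE : #(univ.filter fun x : Fin (6 + 6) → Bool => (Odd (u x / 2) ↔ Odd (u x / 2 / 2))) = 992)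
    (hΦ : (29 / 32 : ℝ) ≤ forrelation f g) :
    forrelation f g = 29 / 32 ∧
    ∃ uf : (Fin (6 + 6) → Bool) → ℤ, (∀ y, W (fun x => signOf (f x)) y = (2 : ℝ) ^ 4 * (uf y : ℝ)) ∧ (∀ y, ¬ Odd (uf y)) ∧
    ∃ v : (Fin (6 + 6) → Bool) → ℤ,
      (∀ x, u x - 4 * sZ (f x) =
        sZ (decide (Odd (u x / 2))) * (1 - 4 * (if (Odd (u x / 2) ↔ Odd (u x / 2 / 2)) then 1 else 0)) + 8 * v x) ∧
      ∑ x, v x ^ 2 = 16 ∧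
      ∃ k : (Fin (6 + 6) → Bool) → ℤ, (∀ y, ∑ x, (v x : ℝ) * twist x y = 8 * (k y : ℝ)) ∧ (∀ y, (2 : ℤ) ∣ k y + uf y) ∧
        (∀ y, k y = 0 ∨ k y = 2 ∨ k y = -2) ∧ #(univ.filter fun y : Fin (6 + 6) → Bool => k y ≠ 0) = 256 := by
  classical
  -- not at `Φ ≥ 930/1024`
  have hlt930 : forrelation f g < 930 / 1024 := by
    by_contra h; push Not at h
    exact to20_typeO_ge930_false f g hf hg u hu hodd h
  have hall : ∀ x, Odd (u x) := TypeOTwelve.typeO_of_exists_odd g u hg hu hodd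
  have hu' : ∀ x, W (fun y => signOf (g y)) x = (2 : ℝ) ^ (2 * 2) * (u x : ℝ) := fun x => (hu x).trans (by norm_num)
  have hd1 : IsDegLeFun 1 (fun x => decide (Odd (u x / 2))) := z2_digitOne 2 g u hg hu' hall
  have hd2 : IsDegLeFun 3 (fun x => decide (Odd (u x / 2 / 2))) := z2_digitTwo 2 g u hg hu' hall
  obtain ⟨c₁, b₁, hcb⟩ := stub_affineForm (6 + 6) _ hd1
  set E := univ.filter (fun x : Fin (6 + 6) → Bool => (Odd (u x / 2) ↔ Odd (u x / 2 / 2))) with hEdef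
  have hdegE : IsDegLeFun (2 + 1) (fun x => (decide (Odd (u x / 2)) ^^ decide (Odd (u x / 2 / 2))) ^^ true) :=
    tb_isDegLeFun_xor_const (bb_isDegLeFun_bxor (hd1.mono (by norm_num)) hd2) true
  have hsetE : (univ.filter fun x : Fin (6 + 6) → Bool =>
      ((decide (Odd (u x / 2)) ^^ decide (Odd (u x / 2 / 2))) ^^ true) = true) = E := by
    rw [hEdef]
    apply filter_congr
    intro x _
    by_cases h1 : Odd (u x / 2) <;> by_cases h2 : Odd (u x / 2 / 2) <;> simp [h1, h2]
  -- budget `Σ τ² = 2¹⁷(1 − Φ) ≤ 12288`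
  obtain ⟨-, -, hT, hbud⟩ := to21_typeO_ge2932_shape f g hg u hu hodd hΦ
  choose v hv using fun x => to12_pt_mod8 (u x) (sZ (f x)) (hall x) (tp_sZ_cases (f x))
  set τ₀ : (Fin (6 + 6) → Bool) → ℤ := fun x =>
    sZ (decide (Odd (u x / 2))) * (1 - 4 * (if (Odd (u x / 2) ↔ Odd (u x / 2 / 2)) then 1 else 0)) with hτ₀def
  have hτ₀val : ∀ x, τ₀ x = 1 ∨ τ₀ x = -1 ∨ τ₀ x = 3 ∨ τ₀ x = -3 := by
    intro x
    simp only [τ₀]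
    rcases tp_sZ_cases (decide (Odd (u x / 2))) with h | h <;> rw [h] <;> split_ifs <;> norm_num
  have hτ₀sq : ∀ x, τ₀ x ^ 2 = 1 + 8 * (if (Odd (u x / 2) ↔ Odd (u x / 2 / 2)) then 1 else 0 : ℤ) := by
    intro x
    simp only [τ₀]
    rcases tp_sZ_cases (decide (Odd (u x / 2))) with h | h <;> rw [h] <;> split_ifs <;> norm_num
  have hsumE : (∑ x, (if (Odd (u x / 2) ↔ Odd (u x / 2 / 2)) then 1 else 0 : ℤ)) = #E := by rw [sum_boole]
  have hsumτ₀ : ∑ x, τ₀ x ^ 2 = 12032 := by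
    rw [sum_congr rfl fun x _ => hτ₀sq x, sum_add_distrib, ← mul_sum, hsumE, sum_const, card_univ, Fintype.card_fun,
      Fintype.card_bool, Fintype.card_fin, hE]
    norm_num
  have hX16 : ∀ x, 16 * v x ^ 2 ≤ (τ₀ x + 8 * v x) ^ 2 - τ₀ x ^ 2 := by
    intro x
    have ht : -3 ≤ τ₀ x ∧ τ₀ x ≤ 3 := by rcases hτ₀val x with h | h | h | h <;> rw [h] <;> norm_num
    have key : 0 ≤ v x * (3 * v x + τ₀ x) := by
      rcases lt_trichotomy (v x) 0 with hlt | heq | hgt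
      · have h1 : 3 * v x + τ₀ x ≤ 0 := by linarith
        nlinarith
      · rw [heq]; simp
      · have h1 : 0 ≤ 3 * v x + τ₀ x := by linarith
        exact mul_nonneg hgt.le h1
    nlinarith [key]
  have hTdec : (∑ x, (u x - 4 * sZ (f x)) ^ 2 : ℤ) = ∑ x, τ₀ x ^ 2 + ∑ x, ((τ₀ x + 8 * v x) ^ 2 - τ₀ x ^ 2) := by
    rw [← sum_add_distrib]; exact sum_congr rfl fun x _ => by rw [hv x]; ring
  have hXV : 16 * ∑ x, v x ^ 2 ≤ ∑ x, ((τ₀ x + 8 * v x) ^ 2 - τ₀ x ^ 2) := by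
    rw [mul_sum]; exact sum_le_sum fun x _ => hX16 x
  have hV : ∑ x, v x ^ 2 ≤ 16 := by
    have h2 : 16 * ∑ x, v x ^ 2 ≤ 256 := by linarith
    omega
  -- the partner and the wild identity
  obtain ⟨uf, huf⟩ := tw_base (n := 6 + 6) f hf 4 (by norm_num)
  have hid : ∀ y, 64 * (uf y : ℝ) = 256 * signOf (g y) -
      signOf b₁ * ((if bxor c₁ y = (fun _ => false) then (2 : ℝ) ^ (6 + 6) else 0) - 4 * ∑ x ∈ E, twist x (bxor c₁ y)) -
      8 * ∑ x, (v x : ℝ) * twist x y := by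
    intro y
    have h := to18_typeO_partner_identity f g u hu v hv c₁ b₁ hcb uf huf y
    rw [← hEdef] at h
    exact h
  have hsb : ((sZ b₁ : ℤ) : ℝ) = signOf b₁ := tp_sZ_cast _
  have hk : ∀ y, ∃ k : ℤ, (∑ x, (v x : ℝ) * twist x y) = 8 * (k : ℝ) ∧ (2 : ℤ) ∣ k + uf y := by
    intro y
    have h := hid y
    by_cases hz : bxor c₁ y = (fun _ => false)
    · rw [if_pos hz] at h
      have hS : ∑ x ∈ E, twist x (bxor c₁ y) = 992 := by
        rw [hz, show (fun _ : Fin (6 + 6) => false) = (zeroVec : Fin (6 + 6) → Bool) from rfl,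
          sum_congr rfl fun x _ => twist_zeroVec_right x, sum_const]
        rw [show #E = 992 from hE]; norm_num
      rw [hS] at h
      refine ⟨4 * sZ (g y) - 2 * sZ b₁ - uf y, ?_, ⟨2 * sZ (g y) - sZ b₁, by ring⟩⟩
      push_cast; rw [tp_sZ_cast, hsb]
      have e : ((2 : ℝ) ^ (6 + 6) - 4 * 992) = 128 := by norm_num
      rw [e] at h
      linarith
    · rw [if_neg hz] at h
      obtain ⟨i₀, hi₀⟩ : ∃ i₀, bxor c₁ y i₀ = true := by
        by_contra hn
        push Not at hn
        exact hz (funext fun i => by simpa using hn i)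
      obtain ⟨m, hm⟩ := to20_char_sum_E992 _ hdegE (by rw [hsetE]; exact hE) (bxor c₁ y) i₀ hi₀
      rw [hsetE] at hm
      rw [hm] at h
      refine ⟨4 * sZ (g y) + 2 * sZ b₁ * m - uf y, ?_, ⟨2 * sZ (g y) + sZ b₁ * m, by ring⟩⟩
      push_cast; rw [tp_sZ_cast, hsb]
      linarith
  choose k hk8 hk2 using hk
  rcases to22_wild_engine16_dichotomy f hf uf huf v hV k hk8 hk2 with hv0 | ⟨hO, hVeq, hkval, hcard⟩
  · -- `v ≡ 0`: zero excess, `Φ = 930/1024` — but `Φ < 930/1024`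
    exfalso
    have hTeq : (∑ x, (u x - 4 * sZ (f x)) ^ 2 : ℤ) = 12032 := by
      rw [← hsumτ₀]; exact sum_congr rfl fun x _ => by rw [hv x, hv0 x]; ring
    have h : ((∑ x, (u x - 4 * sZ (f x)) ^ 2 : ℤ) : ℝ) = 12032 := by exact_mod_cast hTeq
    rw [hbud] at h
    linarith
  · -- sixteen aligned wild points: the budget is exhausted, `Φ = 29/32`
    have h1 := hXV
    rw [hVeq] at h1
    have hTge : (12288 : ℤ) ≤ ∑ x, (u x - 4 * sZ (f x)) ^ 2 := by
      rw [hTdec, hsumτ₀]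
      linarith
    have hTeq : (∑ x, (u x - 4 * sZ (f x)) ^ 2 : ℤ) = 12288 := le_antisymm hT hTge
    have hΦeq : forrelation f g = 29 / 32 := by
      have h : ((∑ x, (u x - 4 * sZ (f x)) ^ 2 : ℤ) : ℝ) = 12288 := by exact_mod_cast hTeq
      rw [hbud] at h
      linarith
    exact ⟨hΦeq, uf, huf, hO, v, hv, hVeq, k, hk8, hk2, hkval, hcard⟩

/-- **No type-O × type-O pair with a base set of `992` points at `Φ ≥ 29/32`** (12 bits).  Finite-slice statement, NOT summit progress.
[this work] -/
theorem to22_typeO_E992_typeO_partner_false (f g : (Fin (6 + 6) → Bool) → Bool) (hf : IsDegLeFun 3 f) (hg : IsDegLeFun 3 g)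
    (u : (Fin (6 + 6) → Bool) → ℤ) (hu : ∀ x, W (fun y => signOf (g y)) x = (2 : ℝ) ^ 4 * (u x : ℝ))
    (hodd : ∃ x, Odd (u x)) (hE : #(univ.filter fun x : Fin (6 + 6) → Bool => (Odd (u x / 2) ↔ Odd (u x / 2 / 2))) = 992)
    (uf : (Fin (6 + 6) → Bool) → ℤ) (huf : ∀ y, W (fun x => signOf (f x)) y = (2 : ℝ) ^ 4 * (uf y : ℝ)) (hoddf : ∃ y, Odd (uf y))
    (hΦ : (29 / 32 : ℝ) ≤ forrelation f g) : False := by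
  obtain ⟨-, uf', huf', hO, -⟩ := to22_typeO_E992_ge2932_dichotomy f g hf hg u hu hodd hE hΦ
  obtain ⟨y, hy⟩ := hoddf
  have heq : uf y = uf' y := by
    have h := (huf y).symm.trans (huf' y)
    have h' : ((uf y : ℤ) : ℝ) = ((uf' y : ℤ) : ℝ) := by
      have h2 : (2 : ℝ) ^ 4 ≠ 0 := by norm_num
      exact mul_left_cancel₀ h2 h
    exact_mod_cast h'
  exact hO y (heq ▸ hy)

end Summit.QuantumAdvantage.QuantumAdvantage.Theorems.CubicForrelation.NearExactIsExact

end
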